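import Literature.NumberTheory.DiophantineGeometry.GeneralizedFermatTwoPowerCoefficientSerreWeightProofs
import Literature.NumberTheory.EllipticCurves.RationalTwoTorsionSemistableModPIrreducibleProofs
import Literature.NumberTheory.EllipticCurves.ModPIrreducibleOfOddSwanConductorProofs
import Literature.NumberTheory.EllipticCurves.HasseWeilAbelianConductorSwanIndependenceTwoProofs
import HarnessLib

/-!
# Ribet 1997, Theorem 3 from `khare_wintenberger` and Mazur's TORSION theorem: Proposition 1
# (irreducibility of `E[p]` for the Frey curves) proved along the printed lines

Topic `Literature/NumberTheory/DiophantineGeometry`; a further sibling *proofs* file (theorems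
only: no definition, no named fact, no `sorry`) of `GeneralizedFermatTwoPowerCoefficient` (named
fact `ribet1997_twoPowerFermat`: K. Ribet, *On the equation `aᵖ + 2^α bᵖ + cᵖ = 0`*, Acta Arith.
79 (1997), Thm. 3).

The sibling `…SerreWeightProofs` proved Theorem 3 from Serre's conjecture (`khare_wintenberger`)
and the Mazur–Kenku classification of rational cyclic isogenies (`mazurKenku_exists_cyclic_isogeny`),
the latter entering only through the irreducibility of `E[p]`, `p ≥ 5`, for the Frey curves
(`hirr`).  Ribet's own route to that irreducibility is his **Proposition 1** (p. 11–12), whose two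
cases this file proves from the tree:

* **semistable case** (`16 ∣ B`): "the result to be proved follows easily from a theorem of Mazur
  … some elliptic curve over `ℚ` which is isogenous to `E` contains a group of rational points
  which is isomorphic to `ℤ/2ℤ ⊕ ℤ/2lℤ`.  The existence of such a curve is incompatible with
  "Ogg's Conjecture", which was proved by Mazur" — the tree's
  `hasIrreducibleModPGaloisRep_of_isSemistable_of_rational_two_torsion_of_mazur_torsion`
  (`RationalTwoTorsionSemistableModPIrreducibleProofs`: Serre 1972 Prop. 21 =
  `Edixhoven1997_prop_2_1_holds`, the quotient isogeny, Galois descent, and Mazur's torsion theorem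
  as the named fact `mazur_torsion`), with the semistability of the Frey curve
  (`isSemistable_freyCurve_of_sixteen_dvd`) and its rational `2`-torsion
  (`smul_eq_of_two_nsmul_eq_zero_freyCurve`);
* **additive case** (`4 ∥ B` or `8 ∥ B`): "the indicated irreducibility follows from a stronger
  statement which is proved by Diamond and Kramer … `δ` is an odd number … `δ` is even" — the
  tree's `hasIrreducibleModPGaloisRep_of_swanConductorAt_torsion_eq_one`
  (`ModPIrreducibleOfOddSwanConductorProofs`: Diamond–Kramer's Lemma 3 with Hasse–Arf), fed with
  `Sw_𝔓(E[p]) = Sw_𝔓(E[3]) = 1` (`swanConductorAt_torsion_eq_swanConductorAt_torsion`: the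
  torsion-level `ℓ`-independence of the wild conductor, from the tree's Tate-module statement
  `swanConductorAt_rationalTate_eq_swanConductorAt_rationalTate`; and the Frey Swan value
  `exists_swanConductorAt_torsion_three_freyCurve_of_sixteen_not_dvd`, Ribet's "`t = 3`").

Results:

* `swanConductorAt_torsion_eq_swanConductorAt_torsion` — `Sw_𝔓(E[ℓ]) = Sw_𝔓(E[ℓ'])` for
  `𝔓 ∣ v ∤ ℓ ℓ'` (any elliptic curve over a number field).
* `swanConductorAt_torsion_freyCurve_eq_one_of_sixteen_not_dvd` — `Sw_𝔓(E[p]) = 1` for the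
  additive Frey curves (`4 ∥ B` or `8 ∥ B`) and every odd prime `p`.
* `hasIrreducibleModPGaloisRep_freyCurve_of_mazur_torsion` — **Ribet 1997, Prop. 1 with its
  Corollary for `p ≥ 5`**: `E[p]` is irreducible for `E = freyCurve A B`, `A ≡ −1 (mod 4)`,
  `4 ∣ B`, `A, B` coprime, granted `mazur_torsion`.
* `ribet1997_twoPowerFermat_of_khare_wintenberger_of_freyOggSaito_canonical'` — the assembly
  `…_of_freyOggSaito_canonical` of `…SerreWeightProofs` verbatim, except that its hypothesis
  `hirr` is only asked for `4 ∣ B` (all that the proof uses: `B = 2^r b^p`, `r ≥ 2`).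
* **`ribet1997_twoPowerFermat_of_khare_wintenberger_of_mazur_torsion`** — Theorem 3 from the two
  named facts `khare_wintenberger` (Serre's conjecture, Khare–Wintenberger 2009 Thm. 1.2) and
  `mazur_torsion` (Mazur 1977, Thm. 8), i.e. from exactly the inputs `[22, 20, 18, 7/8]` and
  `[14]` of the printed proof (modularity and level-lowering being packaged in Serre's conjecture).

## References

* [Ribet1997] K. A. Ribet, Acta Arith. 79 (1997), 7–16: Prop. 1 and Corollary (p. 11–12), Thm. 3,
  §3 (p. 13).
* [Serre1987] J.-P. Serre, Duke Math. J. 54 (1987), §4.1 Prop. 6, (4.1.11)–(4.1.12), §4.2.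
* [Mazur1977] B. Mazur, Publ. Math. IHÉS 47 (1977), Thm. 8.
* [DiamondKramer1995] F. Diamond, K. Kramer, Math. Res. Lett. 2 (1995), Lemma 3.
* [KhareWintenberger2009] C. Khare, J.-P. Wintenberger, Invent. Math. 178 (2009), Thm. 1.2.
* [SilvermanATAEC1994] J. H. Silverman, *Advanced Topics*, Thm. IV.10.2(c).
-/

noncomputable section

open scoped MatrixGroups ModularForm NumberField
open CongruenceSubgroup UpperHalfPlane Polynomial

/-! ## Part A. `Sw_𝔓(E[ℓ])` does not depend on `ℓ` -/

namespace WeierstrassCurve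

open Literature.NumberTheory.EllipticCurves Literature.NumberTheory.GaloisRepresentations
  IsDedekindDomain Field

attribute [local instance] AddSubgroup.torsionBy.zmodModule in
/-- **`Sw_𝔓(E[ℓ]) = Sw_𝔓(E[ℓ'])` for `𝔓 ∣ v ∤ ℓ ℓ'`** (any elliptic curve over a number field):
both equal the Swan conductor of the corresponding Tate module
(`swanConductorAt_rationalTate_eq_swanConductorAt_torsion`), and `Sw_𝔓(V_ℓ E) = Sw_𝔓(V_{ℓ'} E)`
(`swanConductorAt_rationalTate_eq_swanConductorAt_rationalTate`, Silverman *ATAEC* IV.10.2(c)).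
[cite: SilvermanATAEC1994, Thm. IV.10.2(c) and §IV.10 Definition of δ (PDF p. 358)] -/
theorem swanConductorAt_torsion_eq_swanConductorAt_torsion {K : Type} [Field K] [NumberField K]
    (W : WeierstrassCurve K) [W.IsElliptic] (ℓ ℓ' : ℕ) [Fact ℓ.Prime] [Fact ℓ'.Prime]
    {v : HeightOneSpectrum (𝓞 K)} (hℓ : (ℓ : 𝓞 K) ∉ v.asIdeal) (hℓ' : (ℓ' : 𝓞 K) ∉ v.asIdeal)
    {𝔓 : Ideal (absIntegers (𝓞 K) K)} (h𝔓 : 𝔓 ∈ v.primesAbove) :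
    (W.torsionGaloisRep ℓ).swanConductorAt (𝓞 K) 𝔓 =
      (W.torsionGaloisRep ℓ').swanConductorAt (𝓞 K) 𝔓 := by
  rw [← W.swanConductorAt_rationalTate_eq_swanConductorAt_torsion ℓ
      (W.continuous_rationalGaloisRepTate_holds ℓ) hℓ h𝔓,
    ← W.swanConductorAt_rationalTate_eq_swanConductorAt_torsion ℓ'
      (W.continuous_rationalGaloisRepTate_holds ℓ') hℓ' h𝔓]
  exact W.swanConductorAt_rationalTate_eq_swanConductorAt_rationalTate ℓ ℓ' _ _ hℓ hℓ' h𝔓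

end WeierstrassCurve

namespace Literature.NumberTheory.DiophantineGeometry

open WeierstrassCurve GaloisRepresentations EllipticCurves EllipticCurves.ModularForms
  Rat.HeightOneSpectrum IsDedekindDomain IsDedekindDomain.HeightOneSpectrum
  Literature.NumberTheory.Automorphic Literature.NumberTheory.Automorphic.BCDT

/-! ## Part B. Ribet's Proposition 1 for the Frey curves -/

section PropositionOne

variable {A B : ℤ}

/-- An odd natural number is not in the place of `𝓞 ℚ` above `2`. [folklore] -/
theorem natCast_not_mem_asIdeal_of_odd {v : HeightOneSpectrum (𝓞 ℚ)} (hv : (2 : 𝓞 ℚ) ∈ v.asIdeal)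
    {n : ℕ} (hn : Odd n) : ((n : ℕ) : 𝓞 ℚ) ∉ v.asIdeal := by
  intro hmem
  obtain ⟨k, rfl⟩ := hn
  apply v.isPrime.ne_top
  rw [Ideal.eq_top_iff_one]
  have h1 : (1 : 𝓞 ℚ) = ((2 * k + 1 : ℕ) : 𝓞 ℚ) - 2 * (k : 𝓞 ℚ) := by push_cast; ring
  rw [h1]
  exact Ideal.sub_mem _ hmem (Ideal.mul_mem_right _ _ hv)

attribute [local instance] AddSubgroup.torsionBy.zmodModule in
/-- **`Sw_𝔓(E[p]) = 1` for the additive Frey curves** `E = freyCurve A B`, `A ≡ −1 (mod 4)`,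
`4 ∣ B`, `16 ∤ B`, `AB(A+B) ≠ 0`, every odd prime `p`, at some prime `𝔓` of `\bar ℤ` above `2`:
`Sw_𝔓(E[p]) = Sw_𝔓(E[3])` (`swanConductorAt_torsion_eq_swanConductorAt_torsion`) `= 1`
(`exists_swanConductorAt_torsion_three_freyCurve_of_sixteen_not_dvd`, Ribet's "`t = 3`", i.e.
`δ = 1`). [cite: Ribet1997, §2 p. 11 and proof of Prop. 1 (p. 12)] -/
theorem swanConductorAt_torsion_freyCurve_eq_one_of_sixteen_not_dvd (h0 : A * B * (A + B) ≠ 0)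
    (hA : A ≡ -1 [ZMOD 4]) (h4 : (4 : ℤ) ∣ B) (h16 : ¬ (16 : ℤ) ∣ B) (p : ℕ) [Fact p.Prime]
    (hp2 : p ≠ 2) :
    ∃ 𝔓 ∈ ((primesEquiv (R := 𝓞 ℚ)).symm ⟨2, Nat.prime_two⟩).primesAbove,
      ((freyCurve A B).torsionGaloisRep p).swanConductorAt (𝓞 ℚ) 𝔓 = 1 := by
  haveI := isElliptic_freyCurve h0
  haveI : Fact (Nat.Prime 3) := ⟨Nat.prime_three⟩
  set v : HeightOneSpectrum (𝓞 ℚ) := (primesEquiv (R := 𝓞 ℚ)).symm ⟨2, Nat.prime_two⟩ with hv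
  have hv2 : (2 : 𝓞 ℚ) ∈ v.asIdeal := by
    have := (natCast_mem_asIdeal_iff_primesEquiv_eq v Nat.prime_two).mpr
      (by rw [hv, Equiv.apply_symm_apply])
    exact_mod_cast this
  have hpv : ((p : ℕ) : 𝓞 ℚ) ∉ v.asIdeal :=
    natCast_not_mem_asIdeal_of_odd hv2 ((Fact.out : p.Prime).odd_of_ne_two hp2)
  have h3v : ((3 : ℕ) : 𝓞 ℚ) ∉ v.asIdeal := natCast_not_mem_asIdeal_of_odd hv2 (by decide)
  obtain ⟨𝔓, h𝔓, hSw3⟩ := exists_swanConductorAt_torsion_three_freyCurve_of_sixteen_not_dvd h0 hA h4 h16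
  refine ⟨𝔓, h𝔓, ?_⟩
  rw [(freyCurve A B).swanConductorAt_torsion_eq_swanConductorAt_torsion p 3 hpv h3v h𝔓]
  exact hSw3

/-- **Ribet 1997, Proposition 1 (with its Corollary, `p ≥ 5`) for the normalised Frey curves, from
Mazur's torsion theorem.**  Let `A ≡ −1 (mod 4)`, `4 ∣ B`, `A, B` coprime, `AB(A+B) ≠ 0`, and
`p ≥ 5` prime; grant Mazur's torsion theorem for every elliptic curve over `ℚ` (`hMT`).  Then the
`Γ_ℚ`-module `E[p]` of `E : y² = x(x − A)(x + B)` is irreducible: if `16 ∣ B`, `E` is semistable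
(`isSemistable_freyCurve_of_sixteen_dvd`) with rational `2`-torsion
(`smul_eq_of_two_nsmul_eq_zero_freyCurve`), and
`hasIrreducibleModPGaloisRep_of_isSemistable_of_rational_two_torsion_of_mazur_torsion` applies
("follows easily from a theorem of Mazur"); if `16 ∤ B`, `Sw_𝔓(E[p]) = 1` is odd at a prime above
`2` (`swanConductorAt_torsion_freyCurve_eq_one_of_sixteen_not_dvd`) and
`hasIrreducibleModPGaloisRep_of_swanConductorAt_torsion_eq_one` applies (Diamond–Kramer).
[cite: Ribet1997, Prop. 1 and Corollary (p. 11–12)] [cite: Mazur1977, Thm 8]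
[cite: DiamondKramer1995, Lemma 3] -/
theorem hasIrreducibleModPGaloisRep_freyCurve_of_mazur_torsion
    (hMT : ∀ V : WeierstrassCurve ℚ, mazur_torsion V) (hAB : IsCoprime A B)
    (h0 : A * B * (A + B) ≠ 0) (hA : A ≡ -1 [ZMOD 4]) (h4 : (4 : ℤ) ∣ B) {p : ℕ} (hp : p.Prime)
    (h5 : 5 ≤ p) : (freyCurve A B).HasIrreducibleModPGaloisRep p := by
  haveI := isElliptic_freyCurve h0
  haveI : Fact p.Prime := ⟨hp⟩
  by_cases h16 : (16 : ℤ) ∣ B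
  · -- semistable: Mazur's torsion theorem
    exact hasIrreducibleModPGaloisRep_of_isSemistable_of_rational_two_torsion_of_mazur_torsion hMT
      (freyCurve A B) (isSemistable_freyCurve_of_sixteen_dvd hAB h0 hA h16)
      (fun σ P hP ↦ smul_eq_of_two_nsmul_eq_zero_freyCurve h0 σ hP) hp h5
  · -- additive at `2`: Diamond–Kramer's parity argument
    have hp2 : p ≠ 2 := by omega
    obtain ⟨𝔓, h𝔓, hSw⟩ :=
      swanConductorAt_torsion_freyCurve_eq_one_of_sixteen_not_dvd h0 hA h4 h16 p hp2
    set v : HeightOneSpectrum (𝓞 ℚ) := (primesEquiv (R := 𝓞 ℚ)).symm ⟨2, Nat.prime_two⟩ with hv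
    have hv2 : (2 : 𝓞 ℚ) ∈ v.asIdeal := by
      have := (natCast_mem_asIdeal_iff_primesEquiv_eq v Nat.prime_two).mpr
        (by rw [hv, Equiv.apply_symm_apply])
      exact_mod_cast this
    have hpv : ((p : ℕ) : 𝓞 ℚ) ∉ v.asIdeal :=
      natCast_not_mem_asIdeal_of_odd hv2 (hp.odd_of_ne_two hp2)
    exact hasIrreducibleModPGaloisRep_of_swanConductorAt_torsion_eq_one (freyCurve A B) p hpv h𝔓 hSw

end PropositionOne

/-! ## Part C. The assembly with `hirr` restricted to `4 ∣ B`, and Theorem 3 from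
`khare_wintenberger` and `mazur_torsion` -/

section SerreRoad

open ValuativeRel GaloisRepresentations.ModPGaloisRep GaloisRepresentations.IsNonarchimedeanLocalField

/-- **Ribet 1997, Theorem 3 ⟸ Khare–Wintenberger ∧ the local description of `E[p]` away from `p`,
with `hirr` asked only for `4 ∣ B`.**  This is
`ribet1997_twoPowerFermat_of_khare_wintenberger_of_freyOggSaito_canonical` (`…SerreWeightProofs`)
verbatim — same proof, same steps — except that the irreducibility hypothesis `hirr` is quantified
over the Frey curves with `4 ∣ B` instead of `2 ∣ B`: the proof only ever applies it to
`B = 2^r b^p` with `r ≥ 2` (`Ribet1997.monomials` supplies `4 ∣ B`).  This is the exact range of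
Ribet's Theorem 3 (`2 ≤ α`), for which Prop. 1 is proved in Part B.
[cite: Ribet1997, Thm. 3 and §3, p. 13]
[cite: Serre1987, §2.9 Prop. 5, §4.1 (Prop. 6, (4.1.11), (4.1.12)), §4.2, (4.6.3)]
[cite: KhareWintenberger2009, Thm. 1.2 and Thm. 9.1] -/
theorem ribet1997_twoPowerFermat_of_khare_wintenberger_of_freyOggSaito_canonical'
    (hKW : ∀ (p : ℕ) [Fact p.Prime] (k : Type) [Field k] [TopologicalSpace k] [DiscreteTopology k],
      khare_wintenberger p k)
    (hirr : ∀ (A B : ℤ) (p : ℕ), p.Prime → 5 ≤ p → IsCoprime A B → A * B * (A + B) ≠ 0 →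
      A ≡ -1 [ZMOD 4] → (4 : ℤ) ∣ B → (freyCurve A B).HasIrreducibleModPGaloisRep p)
    (hOS : ∀ (A B : ℤ) (p : ℕ) [Fact p.Prime], 5 ≤ p → IsCoprime A B → A * B * (A + B) ≠ 0 →
      A ≡ -1 [ZMOD 4] → (4 : ℤ) ∣ B →
        (freyCurve A B).artinConductorExponent_tate_eq_conductorExponent_of_isElliptic p)
    (hTate : ∀ (W : WeierstrassCurve ℚ) [W.IsElliptic] (p : ℕ) [Fact p.Prime],
      ∀ ρ : ModPGaloisRep ℚ (ZMod p) 2, W.IsTorsionGaloisRep p ρ →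
        ∀ (k : Type) [Field k] [TopologicalSpace k] [DiscreteTopology k] [CharP k p]
          [IsAlgClosed k] (j : ZMod p →+* k) (v : HeightOneSpectrum ℤ),
          natGenerator v ≠ p → W.IsSemistableAt v → p ∣ W.ordMinimalDiscriminant v →
            ¬ natGenerator v ∣ serreLevel p (FramedRep.baseChange j continuous_of_discreteTopology ρ))
    (hDK : ∀ (A B : ℤ), IsCoprime A B → A * B * (A + B) ≠ 0 → A ≡ -1 [ZMOD 4] → (4 : ℤ) ∣ B →
      ¬ (16 : ℤ) ∣ B →
        (freyCurve A B).conductorExponent ((primesEquiv (R := ℤ)).symm ⟨2, Nat.prime_two⟩) ≤ 3) :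
    ribet1997_twoPowerFermat := by
  classical
  rw [ribet1997_twoPowerFermat_iff_normalized]
  intro p hp h5 r h2r hrp a b c h0 hab hac hbc ha heq
  haveI hpF : Fact p.Prime := ⟨hp⟩
  have hodd : Odd p := hp.odd_of_ne_two (by omega)
  have hp2 : p ≠ 2 := by omega
  obtain ⟨hcop, hne, hA, h4, hsum⟩ := Ribet1997.monomials hodd h2r h0 hab hac ha heq
  set W : WeierstrassCurve ℚ := freyCurve (a ^ p) (2 ^ r * b ^ p) with hW
  haveI hWE : W.IsElliptic := isElliptic_freyCurve hne
  /- Step 1. A framed model `ρ̄` of `E[p]` and its extension of scalars `ρ̄' = ρ̄ ⊗ 𝔽̄_p`. -/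
  haveI : NeZero ((p : ℕ) : ℚ) := ⟨by exact_mod_cast hp.ne_zero⟩
  obtain ⟨ρ, hρ⟩ := W.exists_isTorsionGaloisRep p
  letI : TopologicalSpace (AlgebraicClosure (ZMod p)) := ⊥
  haveI : DiscreteTopology (AlgebraicClosure (ZMod p)) := ⟨rfl⟩
  set j : ZMod p →+* AlgebraicClosure (ZMod p) := algebraMap (ZMod p) (AlgebraicClosure (ZMod p))
    with hj
  set ρ' : ModPGaloisRep ℚ (AlgebraicClosure (ZMod p)) 2 :=
    FramedRep.baseChange j continuous_of_discreteTopology ρ with hρ'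
  -- `ρ̄'` is irreducible (`hirr`, now only for `4 ∣ B`) and odd (`det ρ̄ = χ̄_p`)
  have habs := isAbsolutelyIrreducible_of_hasIrreducibleModPGaloisRep W hp2
    (hirr _ _ p hp h5 hcop hne hA h4) hρ
  have hirr' : ρ'.toGaloisRep.IsIrreducible := by
    rw [← ModPGaloisRep.isIrreducible_iff_toGaloisRep]
    exact habs.isIrreducible_baseChange (AlgebraicClosure (ZMod p)) j _
  have hodd' : FramedGaloisRep.IsOdd ρ' :=
    (ModPGaloisRep.isOdd_of_det_eq_modPCyclotomicCharacterZMod ρ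
      (W.det_eq_modPCyclotomicCharacter_of_isTorsionGaloisRep_holds p ρ hρ)).baseChange j _
  /- Step 2. Serre's conjecture (Khare–Wintenberger): `ρ̄'` arises from a newform `f` of weight
  `k(ρ̄')` and level `N(ρ̄')`. -/
  -- the CANONICAL local restriction datum at `p`: `F = ℚ_v`, `v` the place of `ℚ` above `p`
  set v : HeightOneSpectrum (𝓞 ℚ) := (primesEquiv (R := 𝓞 ℚ)).symm ⟨p, hp⟩ with hv_def
  have hpv' : (p : 𝓞 ℚ) ∈ v.asIdeal :=
    (natCast_mem_asIdeal_iff_primesEquiv_eq v hp).mpr (by rw [hv_def, Equiv.apply_symm_apply])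
  set loc : LocalRestrictionAt p ρ' :=
    { F := v.adicCompletion ℚ
      residueFieldCard_eq := residueFieldCard_adicCompletion_eq_of_natCast_mem hpv'
      irreducible_natCast := irreducible_natCast_valuativeInteger_adicCompletion_of_natCast_mem hpv'
      rep := FramedGaloisRep.restrictField (v.adicCompletion ℚ) ρ'
      rep_eq_restrictField := rfl } with hloc
  obtain ⟨ι⟩ := nonempty_ringHom_residue (k := AlgebraicClosure (ZMod p)) p (v.adicCompletion ℚ)
    (residueFieldCard_adicCompletion_eq_of_natCast_mem hpv')
  /- Step 3. The weight is `2`: `E` is semistable at `p` and `p ∣ ord_p (Δ_E)`. -/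
  set vp : HeightOneSpectrum ℤ := (primesEquiv (R := ℤ)).symm ⟨p, hp⟩ with hvp_def
  have hvp : natGenerator vp = p :=
    Literature.NumberTheory.EllipticCurves.Rat.natGenerator_primesEquiv_symm ⟨p, hp⟩
  have hpord : p ∣ W.ordMinimalDiscriminant vp :=
    (Ribet1997.dvd_ordMinimalDiscriminant_of_ne_two hodd h2r h0 hab hac ha heq vp
      (by rw [hvp]; exact hp2)).2
  have hsemi : W.IsSemistableAt vp :=
    isSemistableAt_freyCurve_holds (a ^ p) (2 ^ r * b ^ p) hcop hne vp (by rw [hvp]; exact hp2)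
  have hw : (serreWeight p ρ' loc ι : ℤ) = 2 := by
    have h2 : serreWeight p ρ' loc ι = 2 :=
      serreWeight_eq_two_of_isSemistableAt_of_dvd_ordMinimalDiscriminant W p h5 v hpv' hsemi hpord hρ
        (AlgebraicClosure (ZMod p)) j ι
    rw [h2]; rfl
  -- the newform of (3.2.4), transported to weight `2`
  obtain ⟨f, ιf, hf, hgal⟩ := hKW p (AlgebraicClosure (ZMod p)) ρ' hirr' hodd' loc ι
  revert hgal hf ιf f
  rw [hw]
  intro f ιf hf hgal
  /- Step 4. The level divides `8`. -/
  set N : ℕ := serreLevel p ρ' with hN_def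
  have hN0 : N ≠ 0 := by
    intro h0'
    apply not_dvd_serreLevel p ρ'
    rw [← hN_def, h0']
    exact dvd_zero p
  haveI hNz : NeZero N := ⟨hN0⟩
  have hNE : N ∣ W.conductorNorm ℤ :=
    serreLevel_baseChange_dvd_conductorNorm_of_artinConductorExponent W p
      (hOS _ _ p h5 hcop hne hA h4) ρ hρ (AlgebraicClosure (ZMod p)) j
  have hN8 : N ∣ 8 := by
    refine dvd_eight_of_forall_prime hN0 hNE (conductorNorm_pos_holds W).ne' ?_ ?_
    · -- odd primes of `N` are excluded by `hTate`
      intro q hq hqN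
      by_contra hq2
      have hqp : q ≠ p := by
        rintro rfl
        exact not_dvd_serreLevel q ρ' (by rw [← hN_def]; exact hqN)
      have hqm : (q : ℤ) ∣ a ^ p * (2 ^ r * b ^ p) * (a ^ p + 2 ^ r * b ^ p) :=
        dvd_of_dvd_conductorNorm_freyCurve hcop hne hq hq2 (hqN.trans hNE)
      set u : HeightOneSpectrum ℤ := (primesEquiv (R := ℤ)).symm ⟨q, hq⟩ with hu_def
      have hu : natGenerator u = q :=
        Literature.NumberTheory.EllipticCurves.Rat.natGenerator_primesEquiv_symm ⟨q, hq⟩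
      have hordu : p ∣ W.ordMinimalDiscriminant u :=
        (Ribet1997.dvd_ordMinimalDiscriminant_of_ne_two hodd h2r h0 hab hac ha heq u
          (by rw [hu]; exact hq2)).2
      have hsemiu : W.IsSemistableAt u :=
        isSemistableAt_freyCurve_holds (a ^ p) (2 ^ r * b ^ p) hcop hne u (by rw [hu]; exact hq2)
      have := hTate W p ρ hρ (AlgebraicClosure (ZMod p)) j u (by rw [hu]; exact hqp) hsemiu hordu
      exact this (by rw [hu]; exact hqN)
    · -- `ord₂ N_E ≤ 3`
      rcases Ribet1997.sixteen_dvd_or_odd (by omega : 4 ≤ p) b (r := r) with h16 | ⟨hbo, hr3⟩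
      · exact (factorization_conductorNorm_freyCurve_two_le_one hcop hne hA h16).trans (by norm_num)
      · rw [show (2 : ℕ) = ((⟨2, Nat.prime_two⟩ : Nat.Primes) : ℕ) from rfl,
          factorization_conductorNorm_primesEquiv_symm]
        refine hDK _ _ hcop hne hA h4 ?_
        -- `16 ∤ 2^r b^p` for `b` odd, `r ≤ 3`
        intro h16
        have hb2 : ¬ (2 : ℤ) ∣ b := Int.two_dvd_ne_zero.mpr (Int.odd_iff.mp hbo)
        have hcop2 : IsCoprime ((2 : ℤ) ^ 4) (b ^ p) :=
          ((Int.prime_two.coprime_iff_not_dvd).2 hb2).pow_left.pow_right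
        have h' : (2 : ℤ) ^ 4 ∣ 2 ^ r := hcop2.dvd_of_dvd_mul_right (by exact_mod_cast h16)
        have h'' : 2 ^ 4 ∣ 2 ^ r := by exact_mod_cast h'
        have := (Nat.pow_dvd_pow_iff_le_right one_lt_two).mp h''
        omega
  /- Step 5. The primes `q > |abc|` are primes of good reduction; conclude by
  `false_of_isGaloisRepOfNewform1Int_of_dvd_eight`. -/
  refine false_of_isGaloisRepOfNewform1Int_of_dvd_eight W h5 hρ j hN8 hf ιf hgal
    (max 2 (a * b * c).natAbs) fun q hq hqB ↦ ?_
  have hq2 : q ≠ 2 := fun h' ↦ (lt_of_le_of_lt (le_max_left _ _) hqB).ne' h'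
  have hqabc : ¬ (q : ℤ) ∣ a * b * c := by
    intro h'
    have hle : q ≤ (a * b * c).natAbs :=
      Nat.le_of_dvd (Int.natAbs_pos.mpr h0) (Int.natCast_dvd.mp h')
    exact (lt_of_le_of_lt (le_max_right _ _) hqB).not_ge hle
  refine not_dvd_conductorNorm_freyCurve_of_not_dvd hcop hne hq hq2 ?_
  -- `q ∤ AB(A+B) = -(a^p)(2^r b^p)(c^p)`
  rw [hsum]
  have hqint : Prime (q : ℤ) := Nat.prime_iff_prime_int.mp hq
  have hp0 : p ≠ 0 := hp.ne_zero
  intro h'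
  apply hqabc
  rcases hqint.dvd_or_dvd h' with h' | h'
  · rcases hqint.dvd_or_dvd h' with h' | h'
    · exact dvd_mul_of_dvd_left (dvd_mul_of_dvd_left (hqint.dvd_of_dvd_pow h') _) _
    · rcases hqint.dvd_or_dvd h' with h' | h'
      · exact absurd (eq_two_of_dvd_sixteen hq ((hqint.dvd_of_dvd_pow h').trans (by norm_num)))
          hq2
      · exact dvd_mul_of_dvd_left (dvd_mul_of_dvd_right (hqint.dvd_of_dvd_pow h') _) _
  · exact dvd_mul_of_dvd_right (hqint.dvd_of_dvd_pow (dvd_neg.mp h')) _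

/-- **Ribet 1997, Theorem 3, from `khare_wintenberger` and `mazur_torsion` alone.**  For a prime
`p ≥ 5` and `2 ≤ α < p` the equation `xᵖ + 2^α yᵖ + zᵖ = 0` has no solution in pairwise coprime
non-zero integers (K. Ribet, Acta Arith. 79 (1997), Thm. 3) — granted Serre's conjecture
(Khare–Wintenberger 2009, Thm. 1.2: the named fact `khare_wintenberger`, which packages the
printed inputs "Theorem 5" (modularity, Wiles–Taylor–Wiles–Diamond/Diamond–Kramer) and "the main
theorem of [18]" (level-lowering)) and Mazur's torsion theorem (Mazur 1977, Thm. 8, "Ogg's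
conjecture": the named fact `mazur_torsion`, the input `[14]` of Ribet's Prop. 1).  The assembly
`ribet1997_twoPowerFermat_of_khare_wintenberger_of_freyOggSaito_canonical'` with `hirr` supplied
by `hasIrreducibleModPGaloisRep_freyCurve_of_mazur_torsion` (Ribet's Prop. 1, this file) and the
other Frey-curve inputs discharged exactly as in
`ribet1997_twoPowerFermat_of_khare_wintenberger_of_mazurKenku` (`…SerreWeightProofs`): `hOS`
from `artinConductorExponent_tate_eq_conductorExponent_freyCurve_of_freySwan` and
`exists_swanConductorAt_torsion_three_freyCurve_of_sixteen_not_dvd`, `hTate` from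
`not_dvd_serreLevel_baseChange_of_hasGoodReductionAt_int` /
`not_dvd_serreLevel_baseChange_of_hasMultiplicativeReductionAt_of_dvd_int`, `hDK` from
`conductorExponent_freyCurve_two_le_three`.
[cite: Ribet1997, Thm. 3, Prop. 1, §§2–3] [cite: KhareWintenberger2009, Thm. 1.2]
[cite: Mazur1977, Thm 8] [cite: Serre1987, §4.1 Prop. 6, (4.1.11)–(4.1.12), §4.2] -/
theorem ribet1997_twoPowerFermat_of_khare_wintenberger_of_mazur_torsion
    (hKW : ∀ (p : ℕ) [Fact p.Prime] (k : Type) [Field k] [TopologicalSpace k] [DiscreteTopology k],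
      khare_wintenberger p k)
    (hMT : ∀ V : WeierstrassCurve ℚ, mazur_torsion V) :
    ribet1997_twoPowerFermat := by
  refine ribet1997_twoPowerFermat_of_khare_wintenberger_of_freyOggSaito_canonical'
    hKW (fun _ _ _ hp h5 hcop h0 hA h4 ↦
      hasIrreducibleModPGaloisRep_freyCurve_of_mazur_torsion hMT hcop h0 hA h4 hp h5)
    (fun A B p _ _ hcop h0 hA h4 ↦
      artinConductorExponent_tate_eq_conductorExponent_freyCurve_of_freySwan
        (fun _ _ _ h0 hA h4 h16 ↦
          exists_swanConductorAt_torsion_three_freyCurve_of_sixteen_not_dvd h0 hA h4 h16)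
        hcop h0 hA h4 p)
    ?_ conductorExponent_freyCurve_two_le_three
  intro W _ p _ ρ hρ k _ _ _ _ _ j v hvp hsemi hord
  rcases hsemi with hgood | hmult
  · exact not_dvd_serreLevel_baseChange_of_hasGoodReductionAt_int W p hρ j _ v hvp hgood
  · exact not_dvd_serreLevel_baseChange_of_hasMultiplicativeReductionAt_of_dvd_int W p hρ j _ v hvp
      hmult hord

end SerreRoad

end Literature.NumberTheory.DiophantineGeometry

end
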